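import Mathlib
import Summits.HodgeConjecture.FermatCycles.HodgeFermatHypUAuto
import Summits.HodgeConjecture.FermatCycles.HodgeFermatHypUTailOddB

/-!
# The kernel walk at the levels divisible by 3 (`HodgeFermat/HypUWalk3.lean`; HF-G25)

Tree copy (whole module) of the module `HodgeFermat/HypUWalk3.lean` of the sibling cell's standalone package
`run/shared/lean/pub/pub-hodgefermat/lean/HodgeFermat/` (121 lines, sha256 `102b0a3a0efd9dbb…`), source lines 31–121 (all: `URange3`, the skip certificate `certSkip`, `stepOK`, the walk `walk3` and its soundness, the test walk).
Filed by cell `pub-hfermat`, seat prover-1 gen-3, on the COORDINATOR KEEPER RULING of 2026-08-25 (gem sweep H1: take the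
off-gate kernel theorem `thmFstar` through the gate) — here THEOREM F* of `tables/DPRIME-THEOREM.md` §9 IN FULL, i.e.
PROPOSITION D′(3N) and the descent (`HodgeFermat/PropDPrimeNFinal.lean`, GATE HF-G34), the last off-gate form of THEOREM F*
(its first two forms, `DecodingFinal.thmFstar` = F* at the prime levels and `ThmFstarNFinal.thmFstar` = F*(3N), landed on
2026-08-25 as `HodgeFermatThmFstar.lean` / `HodgeFermatThmFstarN.lean`, seats prover-1 gen-0 / gen-2); this file is one link of
the import closure of `PropDPrimeNFinal.propDprime` (the sibling's KR-free chain: THEOREM L, COROLLARY M, THEOREM D6,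
THEOREM U⁺, THEOREM KR6, THEOREM Z3U) on top of those landed chains.  The source module is the sibling's hub-checked module of
record (pub-hodgefermat `CERT.md` l.906, GATE HF-G25; cell record `check/HypUWalk3_standalone.lean` sha256 `1c715e7b71886135…`); its declarations are copied VERBATIM.
Deviations from the source module, exhaustively: the `import` lines (tree modules `Summits.HodgeConjecture.FermatCycles.
HodgeFermat*` instead of `HodgeFermat.*`); this module docstring; one-line docstrings added (gate lint) to `uRange3_append`, `uRange3_mono`, `certSkip_sound`, `stepOK_sound`, `skip3_eq_false`, `walk3_sound`, `walk3_test`, `uRange3_test`.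
Every other line — in particular every declaration's statement and proof — is byte-identical to the source.
HONEST FRAMING: explicit algebraic cycles for specific Hodge classes on Fermat/Delsarte varieties; residual open instances
listed; no claim on general Hodge.  (This file is arithmetic of CM types / finite combinatorics / analytic number theory
of the sibling's KR-free programme; it claims nothing about cycles.)

The source module's docstring (HypUWalk3.lean l.7–29), verbatim:

## The kernel walk at the levels divisible by 3 (HF-G25)

Generation 24's certificate-free walk `HypUAuto.walkAuto` visits the levels prime to `6`.  Its two
ingredients — the in-kernel certificate generator (`factor`, `entryOf`, `autoEntry`) and the sound checker
`entryOK` (`entryOK_sound : entryOK N e = true → Squarefree N → Good N`) — make no assumption on `N`, so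
the same walk with a different skip rule certifies the level inequality
`Good N : 6 * ∑ p ∈ N.primeFactors, tau N p < φ(N)` at the ODD levels DIVISIBLE BY `3`, except at the
two genuine exceptions `N = 21` (`6·(0+2) = 12 = φ(21)`) and `N = 39` (`6·(4+2) = 36 > 24 = φ(39)`) of
LEMMA S (`tables/SEMI-THEOREM.md` §2).

One economy: the tail `HypUTailOdd.goodTail` already covers every odd squarefree level with `k` prime
factors beyond `XK k` (`100, 700, 5000, 20000, 100000` for `k ≤ 1, 2, 3, 4, 5`, all levels for `k ≥ 6`),
so the walk CERTIFIES A SKIP (`certSkip`: the trial-division factor list consists of distinct primes with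
product `N` — hence `N` is squarefree with exactly that many prime factors — and `N > XK k`) and runs
the order computations only at the `≈ 550` levels `N ≤ XK k` (plus the cheap `S q` check at the
non-squarefree ones).

* `URange3 a b` — `Good N` for every squarefree odd `N ∈ [a, b)` with `3 ∣ N`, `N ∉ {21, 39}`;
* `certSkip`, `certSkip_sound`; `stepOK`, `stepOK_sound`; `walk3`, `walk3_sound`,
  `uRange3_of_walk3 : walk3 (a + k) k = true → URange3 a (a + k)`;
* test `uRange3_test : URange3 3 123`.
-/

set_option autoImplicit false

namespace HodgeFermat.KRFree.HypUOdd

open Finset HodgeFermat.KRFree.HypBReduction HodgeFermat.KRFree.HypUCert HodgeFermat.KRFree.HypUAuto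

/-- the level inequality on the squarefree odd levels `N ∈ [a, b)` divisible by `3`, other than `21, 39`. -/
def URange3 (a b : ℕ) : Prop :=
  ∀ N, a ≤ N → N < b → Squarefree N → ¬ 2 ∣ N → 3 ∣ N → N ≠ 21 → N ≠ 39 → Good N

/-- glue two adjacent ranges of `URange3` -/
theorem uRange3_append {a b c : ℕ} (h1 : URange3 a b) (h2 : URange3 b c) : URange3 a c :=
  fun N ha hc hsq h2N h3N h21 h39 =>
    if hb : N < b then h1 N ha hb hsq h2N h3N h21 h39
    else h2 N (by omega) hc hsq h2N h3N h21 h39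

/-- shrink the upper end of a `URange3` range -/
theorem uRange3_mono {a b c : ℕ} (h : URange3 a b) (hcb : c ≤ b) : URange3 a c :=
  fun N ha hc hsq h2N h3N h21 h39 => h N ha (by omega) hsq h2N h3N h21 h39

/-! ## The certified skip and the step -/

/-- certified skip: `ps` are distinct primes with product `n` (so `n` is squarefree with exactly
`ps.length` prime factors) and `n` lies beyond the tail threshold `XK ps.length` of `HypUTailOdd`. -/
def certSkip (n : ℕ) (ps : List ℕ) : Bool :=
  nodupB ps && ps.all isPrimeB && (ps.prod == n) && Nat.blt (XK ps.length) n

/-- soundness of the skip certificate: `XK ω(n) < n` -/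
theorem certSkip_sound (n : ℕ) (ps : List ℕ) (h : certSkip n ps = true) :
    XK n.primeFactors.card < n := by
  simp only [certSkip, Bool.and_eq_true, List.all_eq_true, beq_iff_eq, Nat.blt_eq] at h
  obtain ⟨⟨⟨hnd, hall⟩, hprod⟩, hlt⟩ := h
  have hnd' := nodup_of_nodupB ps hnd
  have hps : ∀ p ∈ ps, p.Prime := fun p hp => prime_of_isPrimeB p (hall p hp)
  have hpf : n.primeFactors = ps.toFinset := hprod ▸ primeFactors_prod_primes ps hps hnd'
  rw [hpf, List.toFinset_card_of_nodup hnd']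
  exact hlt

/-- one level: skip it with a certificate, or generate and check its order certificate. -/
def stepOK (n : ℕ) : Bool :=
  certSkip n ((factor n).map Prod.fst) || entryOK n (entryOf n (factor n))

/-- a level passing `stepOK` is `Good` -/
theorem stepOK_sound (n : ℕ) (h : stepOK n = true) (hsq : Squarefree n) (h2 : ¬ 2 ∣ n) : Good n := by
  simp only [stepOK, Bool.or_eq_true] at h
  rcases h with h | h
  · exact goodTail n hsq h2 (certSkip_sound n _ h)
  · exact entryOK_sound n _ h hsq

/-! ## The walk -/

/-- the levels NOT visited: even, prime to `3`, or one of the two exceptions. -/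
def skip3 (n : ℕ) : Bool := (n % 2 == 0) || !(n % 3 == 0) || (n == 21) || (n == 39)

/-- an odd level divisible by 3 other than 21, 39 is not skipped -/
theorem skip3_eq_false {n : ℕ} (h2 : ¬ 2 ∣ n) (h3 : 3 ∣ n) (h21 : n ≠ 21) (h39 : n ≠ 39) :
    skip3 n = false := by
  have a : n % 2 ≠ 0 := fun e => h2 (Nat.dvd_of_mod_eq_zero e)
  have b : n % 3 = 0 := Nat.mod_eq_zero_of_dvd h3
  simp [skip3, a, b, h21, h39]

/-- Walk `N = top - fuel, …, top - 1` through `stepOK`. -/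
def walk3 (top : ℕ) : ℕ → Bool
  | 0 => true
  | fuel + 1 =>
      if skip3 (top - (fuel + 1)) then walk3 top fuel
      else stepOK (top - (fuel + 1)) && walk3 top fuel

/-- soundness of the walk `walk3` -/
theorem walk3_sound (top : ℕ) : ∀ fuel : ℕ, walk3 top fuel = true →
    ∀ n, top - fuel ≤ n → n < top → ¬ 2 ∣ n → 3 ∣ n → n ≠ 21 → n ≠ 39 → Squarefree n → Good n
  | 0, _, n, h1, h2, _, _, _, _, _ => by omega
  | fuel + 1, h, n, h1, h2, h2n, h3n, h21, h39, hsq => by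
      unfold walk3 at h
      split_ifs at h with hskip
      · rcases Nat.eq_or_lt_of_le h1 with heq | hlt
        · exfalso
          rw [heq, skip3_eq_false h2n h3n h21 h39] at hskip
          exact Bool.false_ne_true hskip
        · exact walk3_sound top fuel h n (by omega) h2 h2n h3n h21 h39 hsq
      · simp only [Bool.and_eq_true] at h
        rcases Nat.eq_or_lt_of_le h1 with heq | hlt
        · rw [heq] at h
          exact stepOK_sound n h.1 hsq h2n
        · exact walk3_sound top fuel h.2 n (by omega) h2 h2n h3n h21 h39 hsq

/-- The range statement from a checked walk. -/
theorem uRange3_of_walk3 (a k : ℕ) (hw : walk3 (a + k) k = true) : URange3 a (a + k) :=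
  fun n ha hb hsq h2 h3 h21 h39 => walk3_sound (a + k) k hw n (by omega) hb h2 h3 h21 h39 hsq

/-! ## Test (`3 ≤ N < 123`: levels 3, 9 (S 3), 15, 21 (skipped), …, 105 = 3·5·7, 117 (S 3)) -/

/-- the test walk over `3 ≤ N < 123` checks (kernel evaluation) -/
theorem walk3_test : walk3 123 120 = true := by decide +kernel

/-- `URange3 3 123` from the test walk -/
theorem uRange3_test : URange3 3 123 := uRange3_of_walk3 3 120 walk3_test

end HodgeFermat.KRFree.HypUOdd
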